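import Summits.AtomisticToContinuum.Crystallization.Theorems.SlackRigidity.Negative.WitnessBasics
import Literature.Probability.Process.LocallyMatches
import Literature.Probability.Process.PointStationaryLaw
import Literature.Probability.Process.RootedHardCoreConfig
import Mathlib
import HarnessLib

/-!
# `SlackRigidity` (stmt-AtomisticToContinuum-11960): the good-root event is Giry-measurable

Support file for the crux `ThreeConeCertificate.SlackRigidity` (line `ekeland-surgery-parity`,
lead c14's law-rigidity programme, worker stub W1).

The mass-transport (Mecke) argument of the law-level necessary condition integrates the indicator
of the event "the root `0` of the configuration `atoms μ` is `(R, ε)`-good with respect to the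
periodic template `P₀`", i.e.
`∃ A : E3 →ₗᵢ[ℝ] E3, LocallyMatches R ε (atoms μ) (A '' P₀.points)`,
against point-stationary laws on `Measure E3`; the Mecke identity only accepts measurable
integrands, so one needs a version `G ⊆ Measure E3` of this event which is measurable for the Giry
σ-algebra and agrees with it on rooted `δ`-hard-core configurations. This file proves exactly that:
`exists_measurableSet_good`.

## Proof

* The linear isometries of `ℝ³` form a compact subset `Iso` of the (finite-dimensional, hence
  proper and second countable) normed space `E3 →L[ℝ] E3`; pick a countable dense `D ⊆ Iso`.
* For `T : E3 →L[ℝ] E3` and a tolerance `e` the PROXY EVENT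
  `{μ | (∀ p ∈ P₀.points, ‖p‖ ≤ R → μ (closedBall (T p) e) ≠ 0) ∧
        μ (closedBall 0 R \ ⋃ p ∈ P₀.points, closedBall (T p) e) = 0}`
  is Giry-measurable (`P₀.points` is countable), and on a counting measure `count|S` it says that
  `S` and `T '' P₀.points` are two-way `(R, e)`-matched (`count_restrict_mem_proxy_iff`).
* `G := ⋂ k, ⋃ T ∈ D, proxy T (e k)` with `e k ↓ ε`.  A good configuration lies in `G` by density of
  `D` (an isometry `ε`-matching `S` is approximated by `T ∈ D` uniformly on the ball of radius
  `R + ε`, `proxy_of_near`); conversely, from `T_k ∈ D` witnessing the `k`-th proxy one extracts a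
  convergent subsequence `T_{φ j} → T∞ ∈ Iso` (compactness), and local finiteness of both `S`
  (`δ`-separated) and `P₀.points` (periodic) upgrades the approximate matchings to an exact
  `(R, ε)`-matching by `T∞` (`matches_of_tendsto`).

All `[folklore]`.
-/

noncomputable section

open scoped BigOperators Topology
open MeasureTheory Filter Set
open Literature.Probability.Process
open Literature.MathematicalPhysics.StatisticalMechanics
open Summit.AtomisticToContinuum.Crystallization.Theorems.SlackRigidityNegative (E3)

namespace Summit.AtomisticToContinuum.Crystallization.Theorems.SlackRigidityLawGoodMeasurable

/-- The point set of a periodic configuration is countable (it is locally finite). [folklore] -/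
theorem countable_points (P₀ : PeriodicConfiguration 3) : P₀.points.Countable := by
  have h : P₀.points ⊆ ⋃ n : ℕ, (Metric.closedBall (0 : E3) n ∩ P₀.points) := by
    intro z hz
    exact Set.mem_iUnion.2 ⟨⌈‖z‖⌉₊, mem_closedBall_zero_iff.2 (Nat.le_ceil _), hz⟩
  exact (Set.countable_iUnion fun n =>
    (P₀.finite_inter_points Metric.isBounded_closedBall).countable).mono h

/-- The linear isometries of `ℝ³`, viewed inside the continuous linear endomorphisms, form a
compact set: closed (pointwise norm conditions) and bounded (operator norm `≤ 1`) in a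
finite-dimensional normed space. [folklore] -/
theorem isCompact_isometries : IsCompact {T : E3 →L[ℝ] E3 | ∀ x, ‖T x‖ = ‖x‖} := by
  refine Metric.isCompact_of_isClosed_isBounded ?_ ?_
  · rw [Set.setOf_forall]
    exact isClosed_iInter fun x => isClosed_eq (continuous_eval_const x).norm continuous_const
  · refine isBounded_iff_forall_norm_le.2 ⟨1, fun T hT => ?_⟩
    exact ContinuousLinearMap.opNorm_le_bound T zero_le_one fun x => by rw [hT x, one_mul]

/-- **Good ⇒ proxy.** If `S` is two-way `(R, ε)`-matched to `T₀ '' P` for a norm-preserving `T₀`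
(`0 ≤ ε`) and `T` is `η`-close to `T₀` on the ball of radius `R + ε`, then `S` is two-way
`(R, ε + η)`-matched to `T '' P`. [folklore] -/
theorem proxy_of_near {S P : Set E3} {R ε η : ℝ} {T T₀ : E3 →L[ℝ] E3} (hT₀ : ∀ x, ‖T₀ x‖ = ‖x‖)
    (hε : 0 ≤ ε) (hclose : ∀ p : E3, ‖p‖ ≤ R + ε → dist (T₀ p) (T p) ≤ η)
    (h₁ : ∀ p ∈ P, ‖p‖ ≤ R → ∃ q ∈ S, dist q (T₀ p) ≤ ε)
    (h₂ : ∀ q ∈ S, ‖q‖ ≤ R → ∃ p ∈ P, dist q (T₀ p) ≤ ε) :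
    (∀ p ∈ P, ‖p‖ ≤ R → ∃ q ∈ S, dist q (T p) ≤ ε + η) ∧
      (∀ q ∈ S, ‖q‖ ≤ R → ∃ p ∈ P, dist q (T p) ≤ ε + η) := by
  refine ⟨fun p hp hpR => ?_, fun q hq hqR => ?_⟩
  · obtain ⟨q, hq, hd⟩ := h₁ p hp hpR
    exact ⟨q, hq, (dist_triangle q (T₀ p) (T p)).trans (add_le_add hd (hclose p (by linarith)))⟩
  · obtain ⟨p, hp, hd⟩ := h₂ q hq hqR
    have hpR : ‖p‖ ≤ R + ε := by
      have h := dist_triangle (T₀ p) q 0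
      rw [dist_zero_right, dist_zero_right, hT₀ p, dist_comm] at h
      linarith
    exact ⟨p, hp, (dist_triangle q (T₀ p) (T p)).trans (add_le_add hd (hclose p hpR))⟩

/-- **Proxies along a convergent sequence ⇒ good in the limit.** If `S` and `P` are locally
finite, `T j → T'` with every `T j` norm-preserving, `e j → ε` with `e j ≤ ε + 1`, and `S` is
two-way `(R, e j)`-matched to `T j '' P` for every `j`, then `S` is two-way `(R, ε)`-matched to
`T' '' P`: all the partners lie in a fixed finite set, on which strict inequalities pass to the
limit simultaneously. [folklore] -/
theorem matches_of_tendsto {S P : Set E3}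
    (hS : ∀ r : ℝ, (Metric.closedBall (0 : E3) r ∩ S).Finite)
    (hP : ∀ r : ℝ, (Metric.closedBall (0 : E3) r ∩ P).Finite) {R ε : ℝ}
    {T : ℕ → (E3 →L[ℝ] E3)} {T' : E3 →L[ℝ] E3} (hiso : ∀ j x, ‖T j x‖ = ‖x‖)
    (hT : Tendsto T atTop (𝓝 T')) {e : ℕ → ℝ} (he : Tendsto e atTop (𝓝 ε))
    (he1 : ∀ j, e j ≤ ε + 1)
    (h₁ : ∀ j, ∀ p ∈ P, ‖p‖ ≤ R → ∃ q ∈ S, dist q (T j p) ≤ e j)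
    (h₂ : ∀ j, ∀ q ∈ S, ‖q‖ ≤ R → ∃ p ∈ P, dist q (T j p) ≤ e j) :
    (∀ p ∈ P, ‖p‖ ≤ R → ∃ q ∈ S, dist q (T' p) ≤ ε) ∧
      (∀ q ∈ S, ‖q‖ ≤ R → ∃ p ∈ P, dist q (T' p) ≤ ε) := by
  have hTp : ∀ p : E3, Tendsto (fun j => T j p) atTop (𝓝 (T' p)) := fun p =>
    ((continuous_eval_const p).tendsto T').comp hT
  refine ⟨fun p hp hpR => ?_, fun q hq hqR => ?_⟩
  · by_contra H
    push Not at H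
    have hev : ∀ᶠ j in atTop, ∀ q ∈ Metric.closedBall (0 : E3) (R + ε + 1) ∩ S,
        e j < dist q (T j p) :=
      (hS _).eventually_all.2 fun q hq =>
        he.eventually_lt (tendsto_const_nhds.dist (hTp p)) (H q hq.2)
    obtain ⟨j, hj⟩ := hev.exists
    obtain ⟨q, hq, hd⟩ := h₁ j p hp hpR
    have hqB : q ∈ Metric.closedBall (0 : E3) (R + ε + 1) ∩ S := by
      refine ⟨mem_closedBall_zero_iff.2 ?_, hq⟩
      have h := dist_triangle q (T j p) 0
      rw [dist_zero_right, dist_zero_right, hiso j p] at h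
      linarith [he1 j]
    exact absurd hd (not_le.2 (hj q hqB))
  · by_contra H
    push Not at H
    have hev : ∀ᶠ j in atTop, ∀ p ∈ Metric.closedBall (0 : E3) (R + ε + 1) ∩ P,
        e j < dist q (T j p) :=
      (hP _).eventually_all.2 fun p hp =>
        he.eventually_lt (tendsto_const_nhds.dist (hTp p)) (H p hp.2)
    obtain ⟨j, hj⟩ := hev.exists
    obtain ⟨p, hp, hd⟩ := h₂ j q hq hqR
    have hpB : p ∈ Metric.closedBall (0 : E3) (R + ε + 1) ∩ P := by
      refine ⟨mem_closedBall_zero_iff.2 ?_, hp⟩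
      have h := dist_triangle (T j p) q 0
      rw [dist_zero_right, dist_zero_right, hiso j p, dist_comm] at h
      linarith [he1 j]
    exact absurd hd (not_le.2 (hj p hpB))

/-- **The proxy event is Giry-measurable**: for a countable template `P`, a map `T` and a tolerance
`e`, the set of measures charging every ball `closedBall (T p) e` (`p ∈ P`, `‖p‖ ≤ R`) and not
charging `closedBall 0 R` off these balls is measurable (countably many evaluations
`μ ↦ μ B`). [folklore] -/
theorem measurableSet_proxy {P : Set E3} (hPc : P.Countable) (T : E3 →L[ℝ] E3) (R e : ℝ) :
    MeasurableSet {μ : Measure E3 |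
      (∀ p ∈ P, ‖p‖ ≤ R → μ (Metric.closedBall (T p) e) ≠ 0) ∧
        μ (Metric.closedBall 0 R \ ⋃ p ∈ P, Metric.closedBall (T p) e) = 0} := by
  have hU : MeasurableSet (⋃ p ∈ P, Metric.closedBall (T p) e) :=
    MeasurableSet.biUnion hPc fun p _ => Metric.isClosed_closedBall.measurableSet
  rw [Set.setOf_and]
  refine MeasurableSet.inter ?_
    (Measure.measurable_coe (Metric.isClosed_closedBall.measurableSet.diff hU)
      (measurableSet_singleton 0))
  have hrw : {μ : Measure E3 | ∀ p ∈ P, ‖p‖ ≤ R → μ (Metric.closedBall (T p) e) ≠ 0} =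
      ⋂ p ∈ P, {μ : Measure E3 | ‖p‖ ≤ R → μ (Metric.closedBall (T p) e) ≠ 0} := by
    ext μ
    simp only [mem_setOf_eq, mem_iInter]
  rw [hrw]
  refine MeasurableSet.biInter hPc fun p _ => MeasurableSet.imp (MeasurableSet.const _) ?_
  exact (Measure.measurable_coe Metric.isClosed_closedBall.measurableSet
    (measurableSet_singleton 0)).compl

/-- **Proxy event on a counting measure.** For `μ = count|S` the proxy event says exactly that
`S` and `T '' P` are two-way `(R, e)`-matched about the root: every template point `T p`
(`p ∈ P`, `‖p‖ ≤ R`) has a point of `S` within `e`, and every point of `S` in `closedBall 0 R`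
is within `e` of some `T p`. [folklore] -/
theorem count_restrict_mem_proxy_iff {P : Set E3} (hPc : P.Countable) (S : Set E3)
    (T : E3 →L[ℝ] E3) (R e : ℝ) :
    ((∀ p ∈ P, ‖p‖ ≤ R →
        (Measure.count : Measure E3).restrict S (Metric.closedBall (T p) e) ≠ 0) ∧
      (Measure.count : Measure E3).restrict S
        (Metric.closedBall 0 R \ ⋃ p ∈ P, Metric.closedBall (T p) e) = 0) ↔
    (∀ p ∈ P, ‖p‖ ≤ R → ∃ q ∈ S, dist q (T p) ≤ e) ∧
      (∀ q ∈ S, ‖q‖ ≤ R → ∃ p ∈ P, dist q (T p) ≤ e) := by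
  have hU : MeasurableSet (⋃ p ∈ P, Metric.closedBall (T p) e) :=
    MeasurableSet.biUnion hPc fun p _ => Metric.isClosed_closedBall.measurableSet
  refine and_congr (forall₂_congr fun p _ => imp_congr_right fun _ => ?_) ?_
  · rw [Measure.restrict_apply Metric.isClosed_closedBall.measurableSet,
      Measure.count_ne_zero_iff]
    exact ⟨fun ⟨q, hd, hq⟩ => ⟨q, hq, Metric.mem_closedBall.1 hd⟩,
      fun ⟨q, hq, hd⟩ => ⟨q, Metric.mem_closedBall.2 hd, hq⟩⟩
  · rw [Measure.restrict_apply (Metric.isClosed_closedBall.measurableSet.diff hU),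
      Measure.count_eq_zero_iff, Set.eq_empty_iff_forall_notMem]
    constructor
    · intro h q hq hqR
      by_contra hex
      refine h q ⟨⟨mem_closedBall_zero_iff.2 hqR, fun hqU => hex ?_⟩, hq⟩
      obtain ⟨p, hp, hd⟩ := Set.mem_iUnion₂.1 hqU
      exact ⟨p, hp, Metric.mem_closedBall.1 hd⟩
    · rintro h q ⟨⟨hqR, hqU⟩, hq⟩
      obtain ⟨p, hp, hd⟩ := h q hq (mem_closedBall_zero_iff.1 hqR)
      exact hqU (Set.mem_iUnion₂.2 ⟨p, hp, Metric.mem_closedBall.2 hd⟩)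

/-- **The `(R, ε)`-good-root event has a Giry-measurable version on rooted `δ`-hard-core
configurations.** For every periodic template `P₀`, radius `R`, tolerance `ε > 0` and hard-core
parameter `δ > 0` there is a measurable `G ⊆ Measure E3` such that a rooted `δ`-hard-core
configuration `μ = count|S` lies in `G` iff its atoms are two-way `(R, ε)`-matched to a rotation
`A '' P₀.points` of the template (countable dense family of rotations, compactness of the isometry
group, local finiteness of `S` and of `P₀.points`). [folklore] -/
theorem exists_measurableSet_good : ∀ (P₀ : PeriodicConfiguration 3) (R ε δ : ℝ), 0 < ε → 0 < δ →
    ∃ G : Set (Measure E3), MeasurableSet G ∧ ∀ μ : Measure E3, IsRootedHardCore δ μ →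
      (μ ∈ G ↔ ∃ A : E3 →ₗᵢ[ℝ] E3, LocallyMatches R ε (atoms μ) (A '' P₀.points)) := by
  intro P₀ R ε δ hε hδ
  -- the isometries of `ℝ³` inside `E3 →L[ℝ] E3`, compact, with a countable dense subset `D`
  have hIsoc : IsCompact {T : E3 →L[ℝ] E3 | ∀ x, ‖T x‖ = ‖x‖} := isCompact_isometries
  obtain ⟨D, hDI, hDc, hDd⟩ :=
    (TopologicalSpace.IsSeparable.of_separableSpace
      {T : E3 →L[ℝ] E3 | ∀ x, ‖T x‖ = ‖x‖}).exists_countable_dense_subset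
  have hPc : P₀.points.Countable := countable_points P₀
  -- tolerances `e k ↓ ε`
  obtain ⟨e, he, he1, hεe⟩ : ∃ e : ℕ → ℝ, Tendsto e atTop (𝓝 ε) ∧ (∀ k, e k ≤ ε + 1) ∧
      ∀ k, ε < e k := by
    refine ⟨fun k => ε + 1 / ((k : ℝ) + 1), ?_, fun k => ?_, fun k => ?_⟩
    · simpa using tendsto_const_nhds.add (tendsto_one_div_add_atTop_nhds_zero_nat (𝕜 := ℝ))
    · have hk : (0 : ℝ) ≤ k := k.cast_nonneg
      have h1 : 1 / ((k : ℝ) + 1) ≤ 1 := by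
        rw [div_le_one (by linarith)]
        linarith
      simpa using h1
    · simpa using Nat.one_div_pos_of_nat (α := ℝ) (n := k)
  -- the measurable version: `⋂ k, ⋃ T ∈ D, proxy T (e k)`
  refine ⟨⋂ k : ℕ, ⋃ T ∈ D, {μ : Measure E3 |
      (∀ p ∈ P₀.points, ‖p‖ ≤ R → μ (Metric.closedBall (T p) (e k)) ≠ 0) ∧
        μ (Metric.closedBall 0 R \ ⋃ p ∈ P₀.points, Metric.closedBall (T p) (e k)) = 0},
    MeasurableSet.iInter fun k => MeasurableSet.biUnion hDc fun T _ =>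
      measurableSet_proxy hPc T R (e k), ?_⟩
  rintro μ ⟨S, -, hsep, rfl⟩
  rw [atoms_count_restrict]
  simp only [mem_iInter, mem_iUnion, mem_setOf_eq, exists_prop]
  have hSfin : ∀ r : ℝ, (Metric.closedBall (0 : E3) r ∩ S).Finite := fun r =>
    LocalConfig.finite_inter_of_separated hδ hsep (isCompact_closedBall 0 r)
  have hPfin : ∀ r : ℝ, (Metric.closedBall (0 : E3) r ∩ P₀.points).Finite := fun r =>
    P₀.finite_inter_points Metric.isBounded_closedBall
  constructor
  · -- `μ ∈ G` ⇒ good: compactness + local finiteness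
    intro hG
    choose T hTD hTM using hG
    have hTS := fun k => (count_restrict_mem_proxy_iff hPc S (T k) R (e k)).1 (hTM k)
    obtain ⟨T', hT'I, φ, hφ, hlim⟩ := hIsoc.tendsto_subseq fun k => hDI (hTD k)
    have hm := matches_of_tendsto hSfin hPfin (T := T ∘ φ) (fun j => hDI (hTD (φ j))) hlim
      (he.comp hφ.tendsto_atTop) (fun j => he1 (φ j)) (fun j => (hTS (φ j)).1)
      (fun j => (hTS (φ j)).2)
    refine ⟨{ toLinearMap := (T' : E3 →ₗ[ℝ] E3), norm_map' := hT'I }, ?_⟩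
    rw [locallyMatches_image_right_iff]
    refine ⟨fun p hp hpR => ?_, hm.2⟩
    exact hm.1 p hp (by simpa [hT'I p] using hpR)
  · -- good ⇒ `μ ∈ G`: density of `D`
    rintro ⟨A, hA⟩ k
    rw [locallyMatches_image_right_iff] at hA
    have hA1 : ∀ p ∈ P₀.points, ‖p‖ ≤ R → ∃ q ∈ S, dist q (A.toContinuousLinearMap p) ≤ ε :=
      fun p hp hpR => hA.1 p hp (by rwa [A.norm_map])
    have hA2 : ∀ q ∈ S, ‖q‖ ≤ R → ∃ p ∈ P₀.points, dist q (A.toContinuousLinearMap p) ≤ ε :=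
      hA.2
    have hT₀I : A.toContinuousLinearMap ∈ {T : E3 →L[ℝ] E3 | ∀ x, ‖T x‖ = ‖x‖} :=
      fun x => A.norm_map x
    -- margins
    set L : ℝ := max (R + ε) 1 with hL
    have hLpos : 0 < L := lt_of_lt_of_le one_pos (le_max_right _ _)
    have hη : 0 < (e k - ε) / L := div_pos (sub_pos.2 (hεe k)) hLpos
    obtain ⟨T, hTD, hdist⟩ := Metric.mem_closure_iff.1 (hDd hT₀I) _ hη
    have hclose : ∀ p : E3, ‖p‖ ≤ R + ε → dist (A.toContinuousLinearMap p) (T p) ≤ e k - ε := by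
      intro p hp
      rw [dist_eq_norm, ← sub_apply]
      rw [dist_eq_norm] at hdist
      calc ‖(A.toContinuousLinearMap - T) p‖ ≤ ‖A.toContinuousLinearMap - T‖ * ‖p‖ :=
            ContinuousLinearMap.le_opNorm _ _
        _ ≤ ‖A.toContinuousLinearMap - T‖ * L :=
            mul_le_mul_of_nonneg_left (hp.trans (le_max_left _ _)) (norm_nonneg _)
        _ ≤ (e k - ε) / L * L := mul_le_mul_of_nonneg_right hdist.le hLpos.le
        _ = e k - ε := div_mul_cancel₀ _ hLpos.ne'
    have hprox := proxy_of_near (P := P₀.points) hT₀I hε.le hclose hA1 hA2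
    rw [add_sub_cancel] at hprox
    exact ⟨T, hTD, (count_restrict_mem_proxy_iff hPc S T R (e k)).2 hprox⟩

end Summit.AtomisticToContinuum.Crystallization.Theorems.SlackRigidityLawGoodMeasurable

end
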